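import Summits.Ventures.CertifiedManyBodySolver.Upper.IntervalReaderSourcedBoxKernel

/-!
# Ventures/CertifiedManyBodySolver — Upper/IntervalReaderSourcedBoxDensity.lean: the W5 density-window rows through the `l3core-sgf` automaton
(part 23 of the Theorem-H1′ package; parts 1–22: `IntervalReaderSchur` … `IntervalReaderSourcedBoxKernel`)

HONEST FRAMING: first certified bounds; not a superconductivity verdict; every number certified or labelled
float.  A density window is a certified statement about ONE witness's transformed particle number, nothing more;
this file certifies no number and moves no row.

The W5 consumers (`sourcedBoxNode_of_transformedWitness`, ird-5's `sourcedBoxNode_of_producersRows`) take, besides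
the energy row (part 22), the two DENSITY-WINDOW rows of the transformed particle number
`Ñ_phys = |Λ|·1 + Σ_x (n_{x↑} − n_{x↓})` (`gaugedShiba'_conjTranspose_conj_totalNumber`):
`n_lo·ab·⟨ψ̃,ψ̃⟩ ≤ Re⟨ψ̃, Ñ_phys ψ̃⟩ ≤ n_hi·ab·⟨ψ̃,ψ̃⟩`.  `Ñ_phys` is an ON-SITE word sum — the `l3core-sgf` automaton
with no channels at all (`quadWordSum 0 0 V`, `V k = n_↑ − n_↓ + [k = 0]·ab·1`):

* `numberOnSite`, `inner_transformedNumber_eq_quadWordSum` — `star ψ̃ ⬝ᵥ (Ñ_phys *ᵥ ψ̃) = star ψ ⬝ᵥ (quadWordSum 0 0 numberOnSite *ᵥ ψ)`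
  (any bijective enumeration suffices here — no strings — but we keep the monotone `e` of part 22's setting);
* `lower_sound` — part 3's `accept_sound` turned around: `|B − n̂| ≤ r_n`, `|A − ĥ| ≤ r_h`,
  `L·(n̂ − r_n) ≤ ĥ − r_h`, `L·(n̂ + r_n) ≤ ĥ − r_h` ⟹ `L·B ≤ A`;
* `densityWindow_of_reader` — bytes of the `Ñ`-sweep (over `quadAutomaton 0 0 numberOnSite`) and of the `Nrm`-sweep
  with part 12's per-step hypotheses + the two by-value window tests ⟹
  `E_lo · Re⟨ψ̃,ψ̃⟩ ≤ Re⟨ψ̃, Ñ_phys ψ̃⟩ ≤ E_hi · Re⟨ψ̃,ψ̃⟩` (take `E_lo = n_lo·ab`, `E_hi = n_hi·ab`: the consumers'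
  `hlo` / `hhi` verbatim, with `Fintype.card (Fin a ×ₗ Fin b) = a·b`).
-/

noncomputable section

open Matrix Finset WithLp
open scoped BigOperators ComplexOrder Matrix.Norms.L2Operator

namespace Summit.Ventures.CertifiedManyBodySolver.Upper.IntervalReader

open Literature.MathematicalPhysics.QuantumLattice
open Literature.MathematicalPhysics.QuantumLattice.JordanWigner

section Density

variable {a b D : ℕ}

/-- The on-site words of `Ñ_phys = ab·1 + Σ_x (n_{x↑} − n_{x↓})` read along the enumeration: `n_↑ − n_↓`, plus the
constant `ab` at site `0`. -/
def numberOnSite (a b : ℕ) (k : Fin (a * b)) : Matrix (Fin 4) (Fin 4) ℂ :=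
  siteNumber 0 - siteNumber 1 + if (k : ℕ) = 0 then ((a : ℂ) * (b : ℂ)) • 1 else 0

/-- **The transformed particle number IS the channel-free word sum.** -/
theorem inner_transformedNumber_eq_quadWordSum (e : Fin (a * b) ≃ (Fin a ×ₗ Fin b))
    (A : Fin (a * b) → MPSTensor 4 D) (l r : Fin D → ℂ) :
    let Ψ : TensorIndex (Fin a ×ₗ Fin b) 4 → ℂ := fun k => mpsOpenVar (a * b) A l r (fun i => k (e i))
    star (toSpinVec.symm Ψ) ⬝ᵥ
        ((((Fintype.card (Fin a ×ₗ Fin b) : ℂ)) •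
              (1 : Matrix (Finset (Orb (Fin a ×ₗ Fin b))) (Finset (Orb (Fin a ×ₗ Fin b))) ℂ) +
            ∑ x : Fin a ×ₗ Fin b, (numberOp x 0 - numberOp x 1)) *ᵥ toSpinVec.symm Ψ) =
      star (mpsOpenVar (a * b) A l r) ⬝ᵥ
        (quadWordSum (fun _ _ _ _ => 0) (fun _ _ _ _ => 0) (numberOnSite a b) *ᵥ mpsOpenVar (a * b) A l r) := by
  intro Ψ
  have hconv : ∀ X : Matrix (Finset (Orb (Fin a ×ₗ Fin b))) (Finset (Orb (Fin a ×ₗ Fin b))) ℂ,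
      star (toSpinVec.symm Ψ) ⬝ᵥ (X *ᵥ toSpinVec.symm Ψ) = star Ψ ⬝ᵥ (toSpin X *ᵥ Ψ) := fun X => by
    rw [← star_toSpinVec_dotProduct, ← toSpin_mulVec, LinearEquiv.apply_symm_apply]
  have hnorm : star (toSpinVec.symm Ψ) ⬝ᵥ toSpinVec.symm Ψ = star Ψ ⬝ᵥ Ψ := by
    rw [← star_toSpinVec_dotProduct, LinearEquiv.apply_symm_apply]
  have hcard : (Fintype.card (Fin a ×ₗ Fin b) : ℂ) = (a : ℂ) * (b : ℂ) := by
    simp [Lex, Fintype.card_prod]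
  rw [add_mulVec, dotProduct_add, smul_mulVec, one_mulVec, dotProduct_smul, smul_eq_mul, Matrix.sum_mulVec,
    dotProduct_sum, hnorm, hcard, star_compEquiv_dotProduct]
  simp only [sub_mulVec, dotProduct_sub, hconv]
  have hnum : ∀ σ : Fin 2, (∑ x : Fin a ×ₗ Fin b, star Ψ ⬝ᵥ (toSpin (numberOp x σ) *ᵥ Ψ)) =
      ∑ k : Fin (a * b), star (mpsOpenVar (a * b) A l r) ⬝ᵥ
        ((onSite k (siteNumber σ) : Op (Fin (a * b)) 4) *ᵥ mpsOpenVar (a * b) A l r) := by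
    intro σ
    rw [← Fintype.sum_equiv e (fun k => star Ψ ⬝ᵥ (toSpin (numberOp (e k) σ) *ᵥ Ψ)) _ (fun _ => rfl)]
    refine Finset.sum_congr rfl fun k _ => ?_
    rw [toSpin_numberOp_eq_productOp, inner_productOp_compEquiv, update_comp_equiv, ← onSite_eq_productOp]
  rw [Finset.sum_sub_distrib, hnum 0, hnum 1]
  -- the word sum: no channels, on-site words only
  have hW : quadWordSum (fun _ _ _ _ => (0 : ℂ)) (fun _ _ _ _ => (0 : ℂ)) (numberOnSite a b) =
      ∑ k : Fin (a * b), onSite k (numberOnSite a b k) := by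
    rw [quadWordSum]
    simp
  rw [hW, Matrix.sum_mulVec, dotProduct_sum]
  have hsite : ∀ k : Fin (a * b), star (mpsOpenVar (a * b) A l r) ⬝ᵥ
      ((onSite k (numberOnSite a b k) : Op (Fin (a * b)) 4) *ᵥ mpsOpenVar (a * b) A l r) =
      star (mpsOpenVar (a * b) A l r) ⬝ᵥ
          ((onSite k (siteNumber 0) : Op (Fin (a * b)) 4) *ᵥ mpsOpenVar (a * b) A l r) -
        star (mpsOpenVar (a * b) A l r) ⬝ᵥ
          ((onSite k (siteNumber 1) : Op (Fin (a * b)) 4) *ᵥ mpsOpenVar (a * b) A l r) +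
        (if (k : ℕ) = 0 then ((a : ℂ) * (b : ℂ)) else 0) *
          (star (mpsOpenVar (a * b) A l r) ⬝ᵥ mpsOpenVar (a * b) A l r) := by
    intro k
    by_cases hk : (k : ℕ) = 0
    · simp only [numberOnSite, hk, if_true, onSite_add', onSite_sub', onSite_smul', onSite_one', add_mulVec,
        sub_mulVec, smul_mulVec, one_mulVec, dotProduct_add, dotProduct_sub, dotProduct_smul, smul_eq_mul]
    · simp only [numberOnSite, hk, if_false, add_zero, onSite_sub', sub_mulVec, dotProduct_sub, zero_mul]
  simp only [hsite, Finset.sum_add_distrib, Finset.sum_sub_distrib, ← Finset.sum_mul]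
  rw [sum_ite_val_zero _ (fun h0 => by
    rw [show ((a : ℂ) * (b : ℂ)) = ((a * b : ℕ) : ℂ) by push_cast; ring, h0]; simp)]
  ring

/-- **Lower-edge soundness** (part 3's `accept_sound` turned around): enclosures `|B − n̂| ≤ r_n`, `|A − ĥ| ≤ r_h`
and the by-value tests `L·(n̂ − r_n) ≤ ĥ − r_h`, `L·(n̂ + r_n) ≤ ĥ − r_h` give `L·B ≤ A`. -/
theorem lower_sound {A B nh rn hh rh L : ℝ} (hB : |B - nh| ≤ rn) (hA : |A - hh| ≤ rh)
    (hlo : L * (nh - rn) ≤ hh - rh) (hhi : L * (nh + rn) ≤ hh - rh) : L * B ≤ A := by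
  have hA' : |1 * (-A) - (-hh)| ≤ rh := by
    rw [one_mul, show -A - -hh = -(A - hh) by ring, abs_neg]
    exact hA
  have h := accept_sound (A := -A) (E := -L) one_pos hB hA' (by linarith) (by linarith)
  linarith

/-- **Bytes of the `l3core-sgf` reader ⇒ the density window.**  The `Ñ`-sweep runs over the channel-free automaton
`quadAutomaton 0 0 numberOnSite`; `νh` is the real part of the number it reads out, `rν` its radius times the boundary
factor; `nh`, `rn` likewise for the `Nrm`-sweep; the four by-value tests are the two corners of each window edge. -/
theorem densityWindow_of_reader (e : Fin (a * b) ≃ (Fin a ×ₗ Fin b)) (A : Fin (a * b) → MPSTensor 4 D)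
    (l r : Fin D → ℂ) (κ : Fin (a * b) → ℝ) (hκ0 : ∀ k, 0 ≤ κ k)
    (hκ : ∀ k (z : EuclideanSpace ℂ (Fin D)), ∑ s, ‖toLp 2 (A k s *ᵥ ofLp z)‖ ^ 2 ≤ κ k * ‖z‖ ^ 2)
    (Mo : Fin (a * b) → QState (a * b) → QState (a * b) → ℝ) (hM0 : ∀ k b' c, 0 ≤ Mo k b' c)
    (hMrow : ∀ k b' c s, ∑ s', ‖quadAutomaton (fun _ _ _ _ => 0) (fun _ _ _ _ => 0) (numberOnSite a b) k b' c s s'‖ ≤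
      Mo k b' c)
    (hMcol : ∀ k b' c s', ∑ s, ‖quadAutomaton (fun _ _ _ _ => 0) (fun _ _ _ _ => 0) (numberOnSite a b) k b' c s s'‖ ≤
      Mo k b' c)
    (YH : Fin (a * b + 1) → QState (a * b) → Matrix (Fin D) (Fin D) ℂ) (ρH : Fin (a * b) → QState (a * b) → ℝ)
    (hρH : ∀ (k : Fin (a * b)) (c : QState (a * b)),
      ‖YH k.succ c - ∑ b', transferOp (A k) (quadAutomaton (fun _ _ _ _ => 0) (fun _ _ _ _ => 0) (numberOnSite a b)
        k b' c) (YH k.castSucc b')‖ ≤ ρH k c)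
    (radH : Fin (a * b + 1) → QState (a * b) → ℝ)
    (hrH0 : ∀ b', ‖YH 0 b' -
      (Pi.single QState.start (vecMulVec (star l) l) : QState (a * b) → Matrix (Fin D) (Fin D) ℂ) b'‖ ≤ radH 0 b')
    (hrH : ∀ (k : Fin (a * b)) (c : QState (a * b)),
      ∑ b', Mo k b' c * κ k * radH k.castSucc b' + ρH k c ≤ radH k.succ c)
    (YN : Fin (a * b + 1) → Matrix (Fin D) (Fin D) ℂ) (ρN : Fin (a * b) → ℝ)
    (hρN : ∀ k : Fin (a * b), ‖YN k.succ - transferOp (A k) 1 (YN k.castSucc)‖ ≤ ρN k)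
    (radN : Fin (a * b + 1) → ℝ) (hrN0 : ‖YN 0 - vecMulVec (star l) l‖ ≤ radN 0)
    (hrN : ∀ k : Fin (a * b), 1 * κ k * radN k.castSucc + ρN k ≤ radN k.succ)
    (Elo Ehi : ℝ)
    (hlo1 : Elo * ((star r ⬝ᵥ (YN (Fin.last (a * b)) *ᵥ r)).re - (∑ i, ‖r i‖) * (∑ i, ‖r i‖) * radN (Fin.last (a * b)))
      ≤ (star r ⬝ᵥ (YH (Fin.last (a * b)) QState.fin *ᵥ r)).re -
        (∑ i, ‖r i‖) * (∑ i, ‖r i‖) * radH (Fin.last (a * b)) QState.fin)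
    (hlo2 : Elo * ((star r ⬝ᵥ (YN (Fin.last (a * b)) *ᵥ r)).re + (∑ i, ‖r i‖) * (∑ i, ‖r i‖) * radN (Fin.last (a * b)))
      ≤ (star r ⬝ᵥ (YH (Fin.last (a * b)) QState.fin *ᵥ r)).re -
        (∑ i, ‖r i‖) * (∑ i, ‖r i‖) * radH (Fin.last (a * b)) QState.fin)
    (hhi1 : (star r ⬝ᵥ (YH (Fin.last (a * b)) QState.fin *ᵥ r)).re +
        (∑ i, ‖r i‖) * (∑ i, ‖r i‖) * radH (Fin.last (a * b)) QState.fin ≤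
      Ehi * ((star r ⬝ᵥ (YN (Fin.last (a * b)) *ᵥ r)).re - (∑ i, ‖r i‖) * (∑ i, ‖r i‖) * radN (Fin.last (a * b))))
    (hhi2 : (star r ⬝ᵥ (YH (Fin.last (a * b)) QState.fin *ᵥ r)).re +
        (∑ i, ‖r i‖) * (∑ i, ‖r i‖) * radH (Fin.last (a * b)) QState.fin ≤
      Ehi * ((star r ⬝ᵥ (YN (Fin.last (a * b)) *ᵥ r)).re + (∑ i, ‖r i‖) * (∑ i, ‖r i‖) * radN (Fin.last (a * b)))) :
    let Ψ : TensorIndex (Fin a ×ₗ Fin b) 4 → ℂ := fun k => mpsOpenVar (a * b) A l r (fun i => k (e i))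
    Elo * (star (toSpinVec.symm Ψ) ⬝ᵥ toSpinVec.symm Ψ).re ≤
        (star (toSpinVec.symm Ψ) ⬝ᵥ
          ((((Fintype.card (Fin a ×ₗ Fin b) : ℂ)) •
                (1 : Matrix (Finset (Orb (Fin a ×ₗ Fin b))) (Finset (Orb (Fin a ×ₗ Fin b))) ℂ) +
              ∑ x : Fin a ×ₗ Fin b, (numberOp x 0 - numberOp x 1)) *ᵥ toSpinVec.symm Ψ)).re ∧
      (star (toSpinVec.symm Ψ) ⬝ᵥ
          ((((Fintype.card (Fin a ×ₗ Fin b) : ℂ)) •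
                (1 : Matrix (Finset (Orb (Fin a ×ₗ Fin b))) (Finset (Orb (Fin a ×ₗ Fin b))) ℂ) +
              ∑ x : Fin a ×ₗ Fin b, (numberOp x 0 - numberOp x 1)) *ᵥ toSpinVec.symm Ψ)).re ≤
        Ehi * (star (toSpinVec.symm Ψ) ⬝ᵥ toSpinVec.symm Ψ).re := by
  intro Ψ
  have hEq := inner_transformedNumber_eq_quadWordSum e A l r
  have hNq : star (toSpinVec.symm Ψ) ⬝ᵥ toSpinVec.symm Ψ =
      star (mpsOpenVar (a * b) A l r) ⬝ᵥ mpsOpenVar (a * b) A l r := by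
    rw [← star_toSpinVec_dotProduct, LinearEquiv.apply_symm_apply, star_compEquiv_dotProduct]
  rw [hEq, hNq]
  have hH := reader_encloses_quadWordSum_element (fun _ _ _ _ => (0 : ℂ)) (fun _ _ _ _ => (0 : ℂ))
    (numberOnSite a b) A κ hκ0 hκ Mo hM0 hMrow hMcol l l r r YH ρH hρH radH hrH0 hrH
  have hNrm := reader_encloses_productOp_element (a * b) A (fun _ => (1 : Matrix (Fin 4) (Fin 4) ℂ)) κ hκ0 hκ
    (fun _ => (1 : ℝ)) (fun _ => zero_le_one) (fun _ s => (sum_norm_one_apply_row s).le)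
    (fun _ s' => (sum_norm_one_apply_col s').le) (1 : Op (Fin (a * b)) 4) one_apply_eq_prod_one l l r r YN ρN
    hρN radN hrN0 hrN
  rw [Matrix.one_mulVec] at hNrm
  have hA := abs_re_sub_re_le_of_norm_sub_le hH
  have hB := abs_re_sub_re_le_of_norm_sub_le hNrm
  refine ⟨lower_sound hB hA hlo1 hlo2, ?_⟩
  rw [← one_mul ((star (mpsOpenVar (a * b) A l r) ⬝ᵥ
    (quadWordSum (fun _ _ _ _ => (0 : ℂ)) (fun _ _ _ _ => (0 : ℂ)) (numberOnSite a b) *ᵥ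
      mpsOpenVar (a * b) A l r)).re)] at hA
  rw [← one_mul Ehi] at hhi1 hhi2
  exact accept_sound one_pos hB hA hhi1 hhi2

end Density

end Summit.Ventures.CertifiedManyBodySolver.Upper.IntervalReader

end
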